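import Summits.Ventures.CertifiedArithmetic.LowPrec.DirectedMirror

/-!
# Directed rounding: the `RD` (= `RU`) column splits into a toward-zero and an away part

HONEST FRAMING (venture CertifiedArithmetic / cell `pub-lowprec`): certified error envelopes and
provably optimal rounding/accumulation schemes for low-precision formats under stated cost models;
every table by two implementations; no hardware or vendor claims.

THEOREMS-R1 Theorem E5, last clause, third part: over operand sets closed under `flipSign`, the
`roundDown` normal-range relative bound (threshold `lo`, constant `c`) over ALL sums / products is
equivalent to the conjunction of two bounds over the sums / products with NON-NEGATIVE exact value:
the `roundDown` bound there (rounding toward zero in magnitude — by `DirectedRZColumn` this is the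
whole `RZ` column) and the `roundUp` bound there (rounding away from zero in magnitude). Hence
`c_RD = c_RU = max(c_towardzero, c_away)` with `c_towardzero = c_RZ`, which is how the
third-route pattern evaluator `code/enum/envconst.py` computes the directed columns.
[cite: Higham2002ASNA, §2.1]
-/

namespace Literature.ComputerArithmetic.FloatingPoint

namespace MiniFloat

variable {φ₁ φ₂ : Format}

/-- `RD` COLUMN SPLIT, sums: `RD`-bound over all sums ⇔ (`RD`-bound ∧ `RU`-bound) over the sums
with non-negative exact value. [cite: Higham2002ASNA, §2.1] -/
theorem relBound_roundDown_add_iff_nonneg (ψ : Format) (lo c : ℚ) :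
    (∀ (a : MiniFloat φ₁) (b : MiniFloat φ₂), lo ≤ |a.toRat + b.toRat| →
        |a.toRat + b.toRat| ≤ ψ.maxRat →
          |(roundDown ψ (a.toRat + b.toRat)).toRat - (a.toRat + b.toRat)|
            ≤ c * |a.toRat + b.toRat|) ↔
      ((∀ (a : MiniFloat φ₁) (b : MiniFloat φ₂), 0 ≤ a.toRat + b.toRat →
        lo ≤ |a.toRat + b.toRat| → |a.toRat + b.toRat| ≤ ψ.maxRat →
          |(roundDown ψ (a.toRat + b.toRat)).toRat - (a.toRat + b.toRat)|
            ≤ c * |a.toRat + b.toRat|) ∧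
      (∀ (a : MiniFloat φ₁) (b : MiniFloat φ₂), 0 ≤ a.toRat + b.toRat →
        lo ≤ |a.toRat + b.toRat| → |a.toRat + b.toRat| ≤ ψ.maxRat →
          |(roundUp ψ (a.toRat + b.toRat)).toRat - (a.toRat + b.toRat)|
            ≤ c * |a.toRat + b.toRat|)) := by
  constructor
  · intro h
    refine ⟨fun a b _ => h a b, fun a b _ hlo hhi => ?_⟩
    have key := h a.flipSign b.flipSign
    simp only [toRat_flipSign] at key
    rw [show -a.toRat + -b.toRat = -(a.toRat + b.toRat) by ring, abs_neg,
      abs_roundDown_neg_sub] at key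
    exact key hlo hhi
  · rintro ⟨htz, haw⟩ a b hlo hhi
    by_cases h0 : 0 ≤ a.toRat + b.toRat
    · exact htz a b h0 hlo hhi
    · have h0 : a.toRat + b.toRat < 0 := not_le.mp h0
      have key := haw a.flipSign b.flipSign
      simp only [toRat_flipSign] at key
      rw [show -a.toRat + -b.toRat = -(a.toRat + b.toRat) by ring, abs_neg,
        abs_roundUp_neg_sub] at key
      exact key (by linarith) hlo hhi

/-- `RD` COLUMN SPLIT, products: `RD`-bound over all products ⇔ (`RD`-bound ∧ `RU`-bound) over the
products with non-negative exact value (flip `(-a) · b`). [cite: Higham2002ASNA, §2.1] -/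
theorem relBound_roundDown_mul_iff_nonneg (ψ : Format) (lo c : ℚ) :
    (∀ (a : MiniFloat φ₁) (b : MiniFloat φ₂), lo ≤ |a.toRat * b.toRat| →
        |a.toRat * b.toRat| ≤ ψ.maxRat →
          |(roundDown ψ (a.toRat * b.toRat)).toRat - (a.toRat * b.toRat)|
            ≤ c * |a.toRat * b.toRat|) ↔
      ((∀ (a : MiniFloat φ₁) (b : MiniFloat φ₂), 0 ≤ a.toRat * b.toRat →
        lo ≤ |a.toRat * b.toRat| → |a.toRat * b.toRat| ≤ ψ.maxRat →
          |(roundDown ψ (a.toRat * b.toRat)).toRat - (a.toRat * b.toRat)|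
            ≤ c * |a.toRat * b.toRat|) ∧
      (∀ (a : MiniFloat φ₁) (b : MiniFloat φ₂), 0 ≤ a.toRat * b.toRat →
        lo ≤ |a.toRat * b.toRat| → |a.toRat * b.toRat| ≤ ψ.maxRat →
          |(roundUp ψ (a.toRat * b.toRat)).toRat - (a.toRat * b.toRat)|
            ≤ c * |a.toRat * b.toRat|)) := by
  constructor
  · intro h
    refine ⟨fun a b _ => h a b, fun a b _ hlo hhi => ?_⟩
    have key := h a.flipSign b
    simp only [toRat_flipSign] at key
    rw [neg_mul, abs_neg, abs_roundDown_neg_sub] at key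
    exact key hlo hhi
  · rintro ⟨htz, haw⟩ a b hlo hhi
    by_cases h0 : 0 ≤ a.toRat * b.toRat
    · exact htz a b h0 hlo hhi
    · have h0 : a.toRat * b.toRat < 0 := not_le.mp h0
      have key := haw a.flipSign b
      simp only [toRat_flipSign] at key
      rw [neg_mul, abs_neg, abs_roundUp_neg_sub] at key
      exact key (by linarith) hlo hhi

end MiniFloat

end Literature.ComputerArithmetic.FloatingPoint
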